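import Summits.QuantumFields.YangMills.Theorems.FemtoCutoffLadderSubOctaveBoundedUpStepDoor
import Summits.QuantumFields.YangMills.Theses.FemtoCutoffLadder
import HarnessLib

/-!
# Route `FemtoCutoffLadder` — spectral door for crux `DyadicNestedUpper` (stmt-QuantumFields-25766, child of `SubOctaveBounded` 24085):
# nested-dyadic VACUUM-CHAIN COMPARISON ⟹ `DyadicNestedUpper` BY NAME

Seat `ym-line-fcl-p3` (2026-08-28).  The planner's rev-13 child `DyadicNestedUpper` (`z̃(Λ, 2^k·L') ≤ z̃(Λ, L') + CΛ²`, uniform in `k`, `L'`;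
the variational direction) is, pair by pair, the conclusion of the spectral door `UpStep.upStepAt_of_dynComparisonAt`
(`FemtoCutoffLadderSubOctaveBoundedUpStepDoor.lean` §4): on the fine lattice `L = 2^k·L'` it suffices to exhibit, for every physical normalised
exact ground state `Ω` of `K_β`, ONE physical `v ⊥ Ω` whose physical-time-1 vacuum-chain autocorrelation `⟨v,K_β^L v⟩/(λ₀^L‖v‖²)` dominates the
coarse ratio `(λ₁'/λ₀')^{L'}` up to `e^{−CΛ²}` — the intended `v` being the coarse first excitation pulled back along the `k`-fold iterate of the
factor-2 thinning map (`FemtoCutoffLadderThinningDefs`/`…Thinning`: physical, `L²`-isometric) and re-centred.  ★ `dyadicNestedUpper_of_dynComparison`.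

HONEST FRAMING: a door, not a proof — the hypothesis is the two-cutoff (RG) content of 25766 in vacuum-expectation form and is NOT proved here.
R2b1 is a RECORD rung; no summit is proved.  No definitions, no named facts, no `sorry`.
-/

set_option autoImplicit false

namespace Summit.QuantumFields.YangMills.Theorems.FemtoCutoffLadder

open Summit.QuantumFields.YangMills.Theorems.FemtoTransferGap
open Summit.QuantumFields.YangMills.Theses.FemtoCutoffLadder
open Literature.MathematicalPhysics.QuantumFieldTheory (GaugeConfig)

/-- ★ **`DyadicNestedUpper` (stmt-QuantumFields-25766) from the nested-dyadic vacuum-chain comparison.**  Hypothesis (spelled out, same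
quantifier prefix as the item): `∃ C lam0 L₀, ∀ lam ≤ lam0, ∀ k, ∀ L' ≥ L₀, L = 2^k·L'`, matched windows, `∀ Ω` (fine physical normalised exact
ground state) `∃ v ⊥ Ω` physical, `v ≠ 0`, with `λ₁(β',L')^{L'}·λ₀(β,L)^L·‖v‖² ≤ e^{CΛ²}·λ₀(β',L')^{L'}·⟨v,K_β^L v⟩`.  Conclusion: the item, by name
(the argument of `UpStep.upStepAt_of_dynComparisonAt`, run at each pair). [cite: ReedSimonIV1978, Thm. XIII.1] [cite: Balaban1985Averaging] -/
theorem dyadicNestedUpper_of_dynComparison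
    (hD : ∃ (C lam0 : ℝ) (L0 : ℕ), 0 < lam0 ∧ ∀ lam : ℝ, 0 < lam → lam ≤ lam0 →
      ∀ (k : ℕ) (L' : ℕ) [NeZero L'] (L : ℕ) [NeZero L], L0 ≤ L' → L = 2 ^ k * L' →
        ∀ β β' : ℝ, InFemtoWindow lam β L → InFemtoWindow lam β' L' → luscherLambda β L = luscherLambda β' L' →
          ∀ Ω : GaugeConfig 3 L SU2 → ℝ, IsPhys Ω → l2 Ω Ω = 1 → transferApply β Ω = topValue su2Rep L β • Ω →
            ∃ v : GaugeConfig 3 L SU2 → ℝ, IsPhys v ∧ l2 v Ω = 0 ∧ 0 < l2 v v ∧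
              secondValue su2Rep L' β' ^ L' * topValue su2Rep L β ^ L * l2 v v ≤
                Real.exp (C * luscherLambda β L ^ 2) * (topValue su2Rep L' β' ^ L' * l2 v ((transferApply β)^[L] v))) :
    Summit.QuantumFields.YangMills.Theses.FemtoCutoffLadder.DyadicNestedUpper := by
  obtain ⟨C, lam0, L0, hlam0, H⟩ := hD
  refine ⟨C, lam0, L0, hlam0, fun lam hlam hle k L' _ L _ hL0 hL β β' hW hW' hm => ?_⟩
  -- the door argument (`UpStep.upStepAt_of_dynComparisonAt`) at this pair
  have hβ0 : 0 < β := by linarith [hW.1]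
  have hL1 : 1 ≤ L := NeZero.one_le
  obtain ⟨Ω, θ, hΩ, -, hΩ1, hΩeig, -, -, -⟩ := PhysL2.exists_groundState_gap (L := L) β
  obtain ⟨v, hv, hvΩ, hvpos, hcmp⟩ := H lam hlam hle k L' L hL0 hL β β' hW hW' hm Ω hΩ hΩ1 hΩeig
  have hvar := UpStep.l2_iterate_le_pow_secondValue hβ0 hΩ hΩ1 hΩeig hv hvΩ hL1
  have hb' : 0 ≤ topValue su2Rep L' β' ^ L' := pow_nonneg (topValue_su2Rep_pos L' β').le _
  have h1 : Real.exp (C * luscherLambda β L ^ 2) * (topValue su2Rep L' β' ^ L' * l2 v ((transferApply β)^[L] v)) ≤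
      Real.exp (C * luscherLambda β L ^ 2) * (topValue su2Rep L' β' ^ L' * (secondValue su2Rep L β ^ L * l2 v v)) :=
    mul_le_mul_of_nonneg_left (mul_le_mul_of_nonneg_left hvar hb') (Real.exp_pos _).le
  have h2 := hcmp.trans h1
  have h3 : (secondValue su2Rep L' β' ^ L' * topValue su2Rep L β ^ L) * l2 v v ≤
      (Real.exp (C * luscherLambda β L ^ 2) * (secondValue su2Rep L β ^ L * topValue su2Rep L' β' ^ L')) * l2 v v := by
    calc (secondValue su2Rep L' β' ^ L' * topValue su2Rep L β ^ L) * l2 v v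
        = secondValue su2Rep L' β' ^ L' * topValue su2Rep L β ^ L * l2 v v := by ring
      _ ≤ Real.exp (C * luscherLambda β L ^ 2) * (topValue su2Rep L' β' ^ L' * (secondValue su2Rep L β ^ L * l2 v v)) := h2
      _ = (Real.exp (C * luscherLambda β L ^ 2) * (secondValue su2Rep L β ^ L * topValue su2Rep L' β' ^ L')) * l2 v v := by ring
  exact le_of_mul_le_mul_right h3 hvpos

end Summit.QuantumFields.YangMills.Theorems.FemtoCutoffLadder
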